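import Summits.Schanuel.Schanuel.Theorems.DiophantineDichotomyApproximationPropertyBoxModCurve
import HarnessLib

/-!
# The relative box principle in `ℙᵐ` (helper for stub `CycleAPIAt3` of crux `ApproximationProperty`)

Crux `Summit.Schanuel.Schanuel.Theses.DiophantineDichotomy.ApproximationProperty`
(stmt-Schanuel-6117), line `orbit-interpolation-determinant`, stub `CycleAPIAt3 : CycleAPIAt 3`
(siege k4). Every cut of the descent proving `CycleAPIAt t` — in `ℙ²` the landed stubs A
(`stub_ternaryBox`) and C (`stub_boxModCurve`), in `ℙ³` the cuts "small quaternary form", "small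
form modulo the surface `(Q₁)`", "small form modulo the curve `𝔭₂`" — is ONE statement, proved here
once for every `m`, every HOMOGENEOUS ideal `J ⊂ ℚ[x₀, …, x_m]` and every degree `b`:
* `RelativeBox.exists_standard_monomials` — Macaulay: the standard monomials of degree `b`
  (lexicographic order) are `dim ℚ[x]_b − dim J_b` in number and no non-zero polynomial supported
  on them lies in `J` (`Literature.RingTheory.MvPolynomial.finrank_idealDegree_eq_card`);
* `RelativeBox.relativeBox` — if `M ≥ 1` and `M + dim J_b ≤ dim ℚ[x]_b` (any LOWER bound
  `M ≤ H(J; b)`), then for `N ≥ 1` some form `R ∉ J` of degree `b` with integer coefficients of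
  modulus `≤ N` (`1 ≤ |R| ≤ N`, `h(R) ≤ log N`) has
  `|R(1, ω)| · (N+1)^{⌊(M−1)/2⌋} ≤ 6 M max(1,‖ω‖)^b (N+1)` (`Waldschmidt1981.box_principle_complex`
  for one linear form over `M` standard monomials, `k = (N+1)^{⌊(M−1)/2⌋}`, `k² < (N+1)^M`);
* `RelativeBox.relativeBox_exp` — the same as `|R(1, ω)| ≤ exp(c b − ((M − 4)/2) log(N+1))`,
  `c = m + 3 + log max(1, ‖ω‖)`, for `b ≥ 1`;
* `RelativeBox.box_exp` (`J = 0`, `M = binom(b+m, b)`; stub A is `m = 2`) and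
  `RelativeBox.boxModHypersurface_exp` (`J = (Q)`, `M = binom(b+m, b) − binom(b−a+m, b−a)` by the
  hypersurface count `finrank_idealDegree_span_singleton`; stub C is `m = 2`).

For the third cut of `CycleAPIAt 3`, `M` is Chardin–Philippon's lower bound for the Hilbert
function of a curve incompletely defined by two forms (Philippon, IJNT 7 (2011) Lemme 3). Proofs
only. Sources: LNM 1752 Ch. 3 §4; Waldschmidt, Invent. Math. 63 (1981) §3; Cox–Little–O'Shea 6 §3.
-/

set_option linter.dupNamespace false

noncomputable section

namespace Summit.Schanuel.Schanuel.Cruxes.ApproximationProperty.OrbitInterpolationDeterminant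

open Literature.NumberTheory.Transcendental.Nesterenko MvPolynomial Module
open scoped BigOperators

namespace RelativeBox

open Literature.RingTheory.MvPolynomial (idealDegree idealDegree_bot leadingExponents
  mem_leadingExponents finrank_idealDegree_eq_card finrank_idealDegree_sup_span_add_eq
  mem_finsuppAntidiag_univ_iff mem_idealDegree)

/-! ## Standard monomials of degree `b` modulo a homogeneous ideal -/

/-- `dim ℚ[x₀, …, x_m]_b = binom(b + m, b)`. [folklore] -/
theorem finrank_homogeneousSubmodule_eq (m b : ℕ) :
    finrank ℚ ↥(homogeneousSubmodule (Fin (m + 1)) ℚ b) = (b + m).choose b := by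
  rw [Literature.RingTheory.HilbertSamuel.finrank_homogeneousSubmodule_fin,
    show b + (m + 1) - 1 = b + m by omega]

/-- **A monomial basis of `ℚ[x]_b / J_b` (Macaulay).** For a homogeneous ideal `J` of
`ℚ[x₀, …, x_m]` (homogeneity in the explicit form: every homogeneous component of a member is a
member) there is a set `B` of exponents of degree `b` with `#B + dim J_b = dim ℚ[x]_b`
such that no non-zero polynomial supported on `B` lies in `J`: the standard monomials for the
lexicographic order. [folklore] -/
theorem exists_standard_monomials {m : ℕ} {J : Ideal (Rx m)}
    (hJ : ∀ f ∈ J, ∀ d : ℕ, homogeneousComponent d f ∈ J) (b : ℕ) :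
    ∃ B : Finset (Fin (m + 1) →₀ ℕ), (∀ e ∈ B, e.degree = b) ∧
      B.card + finrank ℚ ↥(idealDegree J b) =
        finrank ℚ ↥(homogeneousSubmodule (Fin (m + 1)) ℚ b) ∧
      ∀ R : Rx m, R.support ⊆ B → R ∈ J → R = 0 := by
  classical
  refine ⟨((Finset.univ : Finset (Fin (m + 1))).finsuppAntidiag b).filter
      fun e => e ∉ leadingExponents MonomialOrder.lex J, ?_, ?_, ?_⟩
  · intro e he
    exact mem_finsuppAntidiag_univ_iff.mp (Finset.mem_filter.mp he).1
  · have h1 := finrank_idealDegree_eq_card MonomialOrder.lex J hJ b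
    have h2 := Finset.card_filter_add_card_filter_not
      (s := (Finset.univ : Finset (Fin (m + 1))).finsuppAntidiag b)
      (fun e => e ∈ leadingExponents MonomialOrder.lex J)
    have h3 : ((Finset.univ : Finset (Fin (m + 1))).finsuppAntidiag b).card =
        finrank ℚ ↥(homogeneousSubmodule (Fin (m + 1)) ℚ b) := by
      rw [Finset.card_finsuppAntidiag_nat_eq_choose, Finset.card_univ, Fintype.card_fin,
        finrank_homogeneousSubmodule_eq, show m + 1 + b - 1 = b + m by omega]
    omega
  · intro R hRB hRJ
    by_contra hR0
    have hmem := hRB (MonomialOrder.degree_mem_support (m := MonomialOrder.lex) hR0)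
    rw [Finset.mem_filter] at hmem
    exact hmem.2 ((mem_leadingExponents _).mpr ⟨R, hRJ, hR0, rfl⟩)

/-! ## Arithmetic of the box principle -/

/-- **The shape of the bound.** With `A₀ ≥ 1`, `N ≥ 1`, `M ≥ 1`, `k = (N+1)^{⌊(M−1)/2⌋}`: a quantity
`V ≤ 2(2 M A₀^b N + 1)/k` satisfies `V · (N+1)^{⌊(M−1)/2⌋} ≤ 6 M A₀^b (N+1)`. [folklore] -/
theorem product_bound {A₀ V : ℝ} {b N M k : ℕ} (hA₀ : 1 ≤ A₀) (hM : 1 ≤ M)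
    (hk : k = (N + 1) ^ ((M - 1) / 2))
    (hV : V ≤ 2 * ((2 * (M : ℝ) * A₀ ^ b * N + 1) / k)) :
    V * ((N : ℝ) + 1) ^ ((M - 1) / 2) ≤ 6 * M * A₀ ^ b * ((N : ℝ) + 1) := by
  have hkR : (k : ℝ) = ((N : ℝ) + 1) ^ ((M - 1) / 2) := by rw [hk]; push_cast; ring
  have hk0 : (0 : ℝ) < k := by rw [hkR]; positivity
  have hMR : (1 : ℝ) ≤ M := by exact_mod_cast hM
  have hAb1 : 1 ≤ A₀ ^ b := one_le_pow₀ hA₀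
  have hN0 : (0 : ℝ) ≤ N := Nat.cast_nonneg N
  have h1 : V ≤ 6 * M * A₀ ^ b * ((N : ℝ) + 1) / k := by
    refine hV.trans ?_
    rw [mul_div_assoc']
    apply div_le_div_of_nonneg_right _ hk0.le
    have hMA : 1 ≤ (M : ℝ) * A₀ ^ b := by nlinarith
    have hMAN : 0 ≤ (M : ℝ) * A₀ ^ b * N := by positivity
    nlinarith
  rw [← hkR]
  rwa [le_div_iff₀ hk0] at h1

/-- From the product form to the exponential form: `⌊(M−1)/2⌋ ≥ (M−2)/2` and
`6 M ≤ e^{2 + b + m}` when `M ≤ 2^{b+m}`, so `V ≤ exp((m + 3 + log A₀) b − ((M−4)/2) log(N+1))` for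
`b ≥ 1`. [folklore] -/
theorem exp_bound {A₀ V : ℝ} {m b N M : ℕ} (hA₀ : 1 ≤ A₀) (hb : 1 ≤ b)
    (hMle : M ≤ 2 ^ (b + m)) (hV0 : 0 ≤ V)
    (hV : V * ((N : ℝ) + 1) ^ ((M - 1) / 2) ≤ 6 * M * A₀ ^ b * ((N : ℝ) + 1)) :
    V ≤ Real.exp ((m + 3 + Real.log A₀) * b - ((M : ℝ) - 4) / 2 * Real.log ((N : ℝ) + 1)) := by
  set L := Real.log ((N : ℝ) + 1) with hL
  have hN1 : (1 : ℝ) ≤ (N : ℝ) + 1 := by linarith [Nat.cast_nonneg (α := ℝ) N]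
  have hL0 : 0 ≤ L := Real.log_nonneg hN1
  have hexpL : Real.exp L = (N : ℝ) + 1 := Real.exp_log (by linarith)
  have hA0 : 0 < A₀ := by linarith
  have hlogA : 0 ≤ Real.log A₀ := Real.log_nonneg hA₀
  -- `(N+1)^{⌊(M-1)/2⌋} = exp(⌊(M-1)/2⌋ L) ≥ exp(((M-2)/2) L)`
  have hq : ((M : ℝ) - 2) / 2 ≤ (((M - 1) / 2 : ℕ) : ℝ) := by
    rcases Nat.lt_or_ge M 2 with hM2 | hM2
    · have : (M : ℝ) < 2 := by exact_mod_cast hM2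
      have h0 : (0 : ℝ) ≤ (((M - 1) / 2 : ℕ) : ℝ) := Nat.cast_nonneg _
      linarith
    · have h2 : M - 2 ≤ 2 * ((M - 1) / 2) := by omega
      have h2R : ((M - 2 : ℕ) : ℝ) ≤ 2 * (((M - 1) / 2 : ℕ) : ℝ) := by exact_mod_cast h2
      rw [Nat.cast_sub hM2] at h2R
      push_cast at h2R
      linarith
  have hpow : Real.exp (((M : ℝ) - 2) / 2 * L) ≤ ((N : ℝ) + 1) ^ ((M - 1) / 2) := by
    rw [← hexpL, ← Real.exp_nat_mul]
    exact Real.exp_le_exp.mpr (mul_le_mul_of_nonneg_right hq hL0)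
  -- `6 M A₀^b (N+1) ≤ exp(2 + (b + m) + b log A₀ + L)`
  have h2e : (2 : ℝ) ≤ Real.exp 1 := by linarith [Real.add_one_le_exp (1 : ℝ)]
  have hMR : (M : ℝ) ≤ Real.exp ((b : ℝ) + m) := by
    have h1 : (M : ℝ) ≤ (2 : ℝ) ^ (b + m) := by exact_mod_cast hMle
    have h2 : (2 : ℝ) ^ (b + m) ≤ Real.exp 1 ^ (b + m) := pow_le_pow_left₀ (by norm_num) h2e _
    rw [← Real.exp_nat_mul, mul_one, Nat.cast_add] at h2
    exact h1.trans h2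
  have h6 : (6 : ℝ) ≤ Real.exp 2 := by
    have h22 : Real.exp 2 = Real.exp 1 * Real.exp 1 := by rw [← Real.exp_add]; norm_num
    have he := Real.exp_one_gt_d9
    nlinarith [Real.exp_pos (1 : ℝ)]
  have hAb : A₀ ^ b = Real.exp (b * Real.log A₀) := by
    rw [Real.exp_nat_mul, Real.exp_log hA0]
  have hrhs : 6 * (M : ℝ) * A₀ ^ b * ((N : ℝ) + 1) ≤
      Real.exp (2 + ((b : ℝ) + m) + b * Real.log A₀ + L) := by
    rw [Real.exp_add, Real.exp_add, Real.exp_add, ← hAb, hexpL]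
    have hM0 : (0 : ℝ) ≤ M := Nat.cast_nonneg M
    have hAb0 : 0 ≤ A₀ ^ b := by positivity
    have hN0 : (0 : ℝ) ≤ (N : ℝ) + 1 := by linarith
    gcongr
  have hmain : V * Real.exp (((M : ℝ) - 2) / 2 * L) ≤
      Real.exp (2 + ((b : ℝ) + m) + b * Real.log A₀ + L) :=
    le_trans (mul_le_mul_of_nonneg_left hpow hV0) (hV.trans hrhs)
  rw [← le_div_iff₀ (Real.exp_pos _), ← Real.exp_sub] at hmain
  refine hmain.trans (Real.exp_le_exp.mpr ?_)
  have hbR : (1 : ℝ) ≤ b := by exact_mod_cast hb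
  have hmR : (0 : ℝ) ≤ m := Nat.cast_nonneg m
  nlinarith [hL0, hlogA, hbR, hmR]

/-! ## The relative box principle -/

/-- **The relative box principle in `ℙᵐ`.** Let `J ⊂ ℚ[x₀, …, x_m]` be a homogeneous ideal, `b` a
degree and `M ≥ 1` an integer with `M + dim J_b ≤ dim ℚ[x]_b` (a lower bound for the Hilbert
function `H(J; b)`). For every `ω ∈ ℂᵐ` and `N ≥ 1` there is a form `R ∉ J` of degree `b` with
integer coefficients of modulus `≤ N` — so `1 ≤ |R| ≤ N` and `h(R) ≤ log N` — and
`|R(1, ω)| · (N+1)^{⌊(M−1)/2⌋} ≤ 6 M max(1, ‖ω‖)^b (N+1)` (box principle for one complex linear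
form over `M` standard monomials). [folklore] -/
theorem relativeBox {m : ℕ} (ω : Fin m → ℂ) {J : Ideal (Rx m)}
    (hJ : ∀ f ∈ J, ∀ d : ℕ, homogeneousComponent d f ∈ J) {b M N : ℕ} (hM : 1 ≤ M)
    (hMJ : M + finrank ℚ ↥(idealDegree J b) ≤ finrank ℚ ↥(homogeneousSubmodule (Fin (m + 1)) ℚ b))
    (hN : 1 ≤ N) :
    ∃ R : Rx m, R ∉ J ∧ R.IsHomogeneous b ∧ 1 ≤ maxNorm R ∧ maxNorm R ≤ N ∧
      height R ≤ Real.log N ∧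
      ‖aeval (Fin.cons 1 ω : Fin (m + 1) → ℂ) R‖ * ((N : ℝ) + 1) ^ ((M - 1) / 2) ≤
        6 * M * (max 1 ‖ω‖) ^ b * ((N : ℝ) + 1) := by
  classical
  have hA₀ : 1 ≤ max 1 ‖ω‖ := le_max_left _ _
  obtain ⟨B, hBdeg, hBcard, hBind⟩ := exists_standard_monomials hJ b
  have hMB : M ≤ B.card := by omega
  obtain ⟨B', hB'B, hB'card⟩ := Finset.exists_subset_card_eq hMB
  have hB'deg : ∀ e ∈ B', e.degree = b := fun e he => hBdeg e (hB'B he)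
  -- the point `ω̄ = (1, ω)` and the values of the monomials at it
  set ω' : Fin (m + 1) → ℂ := Fin.cons 1 ω with hω'def
  have hω' : ∀ i, ‖ω' i‖ ≤ max 1 ‖ω‖ := by
    refine Fin.cases ?_ ?_
    · simp [hω'def]
    · intro i
      rw [hω'def, Fin.cons_succ]
      exact (norm_le_pi_norm ω i).trans (le_max_right _ _)
  have hval : ∀ e : Fin (m + 1) →₀ ℕ, e.degree = b →
      ‖e.prod fun i k => ω' i ^ k‖ ≤ (max 1 ‖ω‖) ^ b := by
    intro e he
    rw [Finsupp.prod, norm_prod]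
    calc ∏ i ∈ e.support, ‖ω' i ^ e i‖ ≤ ∏ i ∈ e.support, (max 1 ‖ω‖) ^ e i := by
          refine Finset.prod_le_prod (fun i _ => norm_nonneg _) fun i _ => ?_
          rw [norm_pow]
          exact pow_le_pow_left₀ (norm_nonneg _) (hω' i) _
      _ = (max 1 ‖ω‖) ^ b := by rw [Finset.prod_pow_eq_pow_sum, ← Finsupp.degree_apply, he]
  obtain ⟨k, hk⟩ : ∃ k : ℕ, k = (N + 1) ^ ((M - 1) / 2) := ⟨_, rfl⟩
  have hk0 : 0 < k := by rw [hk]; positivity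
  have hlt : k ^ (2 * Fintype.card (Fin 1)) < (N + 1) ^ Fintype.card ↥B' := by
    rw [Fintype.card_coe, Fintype.card_fin, mul_one, hk, hB'card, ← pow_mul]
    exact Nat.pow_lt_pow_right (by omega) (by omega)
  obtain ⟨p, hp0, hpN, hpsmall⟩ :=
    Literature.NumberTheory.Transcendental.Waldschmidt1981.box_principle_complex
      (fun (_ : Fin 1) (j : ↥B') => (j : Fin (m + 1) →₀ ℕ).prod fun i k => ω' i ^ k)
      (A := (max 1 ‖ω‖) ^ b) (by positivity) (fun _ j => hval j (hB'deg j j.2)) N k hk0 hlt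
  -- the form `R = ∑ p_β x^β`
  obtain ⟨Z, hZ⟩ : ∃ Z : MvPolynomial (Fin (m + 1)) ℤ,
      Z = ∑ j : ↥B', monomial (j : Fin (m + 1) →₀ ℕ) (p j) := ⟨_, rfl⟩
  obtain ⟨R, hRZ⟩ : ∃ R : Rx m, R = MvPolynomial.map (Int.castRingHom ℚ) Z := ⟨_, rfl⟩
  have hR : R = ∑ j : ↥B', monomial (j : Fin (m + 1) →₀ ℕ) ((p j : ℤ) : ℚ) := by
    rw [hRZ, hZ, map_sum]
    simp only [map_monomial, eq_intCast]
  have hcoeff : ∀ e, R.coeff e = if h : e ∈ B' then ((p ⟨e, h⟩ : ℤ) : ℚ) else 0 := by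
    intro e
    rw [hR, coeff_sum]
    simp only [coeff_monomial]
    split_ifs with h
    · rw [Finset.sum_eq_single (⟨e, h⟩ : ↥B')]
      · simp
      · intro j _ hj
        rw [if_neg]
        exact fun h' => hj (Subtype.ext h')
      · intro h'
        exact absurd (Finset.mem_univ _) h'
    · refine Finset.sum_eq_zero fun j _ => ?_
      rw [if_neg]
      rintro rfl
      exact h j.2
  have hsupp : R.support ⊆ B := by
    intro e he
    by_contra h
    have h' : e ∉ B' := fun he' => h (hB'B he')
    rw [MvPolynomial.mem_support_iff, hcoeff e, dif_neg h'] at he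
    exact he rfl
  obtain ⟨j₀, hj₀⟩ := Function.ne_iff.mp hp0
  have hj₀' : p j₀ ≠ 0 := by simpa using hj₀
  have hRj₀ : R.coeff j₀ = p j₀ := by rw [hcoeff, dif_pos j₀.2]
  have hR0 : R ≠ 0 := by
    intro h
    rw [h, coeff_zero] at hRj₀
    exact hj₀' (by exact_mod_cast hRj₀.symm)
  have hZ0 : Z ≠ 0 := fun h => hR0 (by rw [hRZ, h, map_zero])
  have hmax1 : 1 ≤ maxNorm R := by
    refine le_trans ?_ (norm_coeff_le_maxNorm R j₀)
    rw [hRj₀, Int.norm_cast_rat, Int.norm_eq_abs]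
    exact_mod_cast Int.one_le_abs hj₀'
  have hmaxN : maxNorm R ≤ N := by
    refine CycleAPIOne.maxNorm_le_of_forall_le R (Nat.cast_nonneg N) fun e => ?_
    rw [hcoeff]
    split_ifs with h
    · rw [Int.norm_cast_rat, Int.norm_eq_abs]
      have := hpN ⟨e, h⟩
      exact_mod_cast this
    · rw [norm_zero]
      exact Nat.cast_nonneg N
  refine ⟨R, fun hRJ => hR0 (hBind R hsupp hRJ), ?_, hmax1, hmaxN, ?_, ?_⟩
  · rw [hR]
    exact IsHomogeneous.sum _ _ _ fun j _ => isHomogeneous_monomial _ (hB'deg _ j.2)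
  · have hh := height_map_le_log_maxNorm Z hZ0
    rw [← hRZ] at hh
    exact hh.trans (Real.log_le_log (by linarith) hmaxN)
  · have hval_eq : aeval ω' R =
        ∑ j : ↥B', (p j : ℂ) * (j : Fin (m + 1) →₀ ℕ).prod fun i k => ω' i ^ k := by
      rw [hR, map_sum]
      refine Finset.sum_congr rfl fun j _ => ?_
      rw [aeval_monomial, eq_ratCast, Rat.cast_intCast]
    rw [hval_eq]
    have h := hpsmall 0
    simp only [Fintype.card_coe, hB'card] at h
    exact product_bound hA₀ hM hk h

/-- **The relative box principle, exponential form.** Under the hypotheses of `relativeBox` and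
`b ≥ 1`: `|R(1, ω)| ≤ exp(c b − ((M − 4)/2) log(N+1))` with `c = m + 3 + log max(1, ‖ω‖)`.
[folklore] -/
theorem relativeBox_exp {m : ℕ} (ω : Fin m → ℂ) {J : Ideal (Rx m)}
    (hJ : ∀ f ∈ J, ∀ d : ℕ, homogeneousComponent d f ∈ J) {b M N : ℕ} (hb : 1 ≤ b)
    (hM : 1 ≤ M)
    (hMJ : M + finrank ℚ ↥(idealDegree J b) ≤ finrank ℚ ↥(homogeneousSubmodule (Fin (m + 1)) ℚ b))
    (hN : 1 ≤ N) :
    ∃ R : Rx m, R ∉ J ∧ R.IsHomogeneous b ∧ 1 ≤ maxNorm R ∧ maxNorm R ≤ N ∧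
      height R ≤ Real.log N ∧
      ‖aeval (Fin.cons 1 ω : Fin (m + 1) → ℂ) R‖ ≤
        Real.exp ((m + 3 + Real.log (max 1 ‖ω‖)) * b -
          ((M : ℝ) - 4) / 2 * Real.log ((N : ℝ) + 1)) := by
  obtain ⟨R, hRJ, hRb, h1, hN', hh, hsmall⟩ := relativeBox ω hJ hM hMJ hN
  refine ⟨R, hRJ, hRb, h1, hN', hh, ?_⟩
  have hMle : M ≤ 2 ^ (b + m) := by
    have h1 : M ≤ finrank ℚ ↥(homogeneousSubmodule (Fin (m + 1)) ℚ b) := by omega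
    rw [finrank_homogeneousSubmodule_eq] at h1
    exact h1.trans (Nat.choose_le_two_pow _ _)
  exact exp_bound (le_max_left _ _) hb hMle (norm_nonneg _) hsmall

/-! ## `J = 0`: the box principle for `(m+1)`-ary forms -/

/-- **The box principle for forms in `ℙᵐ`** (`J = 0`, `M = dim ℚ[x₀, …, x_m]_b = binom(b+m, b)`):
for `ω ∈ ℂᵐ`, `b ≥ 1`, `N ≥ 1` some NON-ZERO form `P` of degree `b` with integer coefficients of
modulus `≤ N` has `|P(1, ω)| ≤ exp(c b − ((binom(b+m,b) − 4)/2) log(N+1))`,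
`c = m + 3 + log max(1, ‖ω‖)`. [folklore] -/
theorem box_exp {m : ℕ} (ω : Fin m → ℂ) {b N : ℕ} (hb : 1 ≤ b) (hN : 1 ≤ N) :
    ∃ P : Rx m, P ≠ 0 ∧ P.IsHomogeneous b ∧ 1 ≤ maxNorm P ∧ maxNorm P ≤ N ∧
      height P ≤ Real.log N ∧
      ‖aeval (Fin.cons 1 ω : Fin (m + 1) → ℂ) P‖ ≤
        Real.exp ((m + 3 + Real.log (max 1 ‖ω‖)) * b -
          (((b + m).choose b : ℝ) - 4) / 2 * Real.log ((N : ℝ) + 1)) := by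
  have hJ : ∀ f ∈ (⊥ : Ideal (Rx m)), ∀ d : ℕ, homogeneousComponent d f ∈ (⊥ : Ideal (Rx m)) :=
    fun f hf d => by
      rw [Ideal.mem_bot] at hf ⊢
      rw [hf, map_zero]
  have hM : 1 ≤ (b + m).choose b := Nat.choose_pos (by omega)
  have hMJ : (b + m).choose b + finrank ℚ ↥(idealDegree (⊥ : Ideal (Rx m)) b) ≤
      finrank ℚ ↥(homogeneousSubmodule (Fin (m + 1)) ℚ b) := by
    rw [idealDegree_bot, finrank_bot, add_zero, finrank_homogeneousSubmodule_eq]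
  obtain ⟨R, hRJ, hRb, h1, hN', hh, hsmall⟩ := relativeBox_exp ω hJ hb hM hMJ hN
  refine ⟨R, fun h => hRJ (by rw [h]; exact Ideal.zero_mem _), hRb, h1, hN', hh, ?_⟩
  exact_mod_cast hsmall

/-! ## `J = (Q)`: the box principle modulo a hypersurface -/

/-- **`dim (Q)_{t+a} = dim ℚ[x₀, …, x_m]_t`** for a non-zero form `Q` of degree `a` (hypersurface
section of the zero ideal by the non-zero-divisor `Q`). [folklore] -/
theorem finrank_idealDegree_span_singleton {m : ℕ} {Q : Rx m} {a : ℕ} (hQ : Q.IsHomogeneous a)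
    (hQ0 : Q ≠ 0) (t : ℕ) :
    finrank ℚ ↥(idealDegree (Ideal.span {Q}) (t + a)) =
      finrank ℚ ↥(homogeneousSubmodule (Fin (m + 1)) ℚ t) := by
  letI := MvPolynomial.gradedAlgebra (σ := Fin (m + 1)) (R := ℚ)
  have h := finrank_idealDegree_sup_span_add_eq (I := (⊥ : Ideal (Rx m)))
    (Ideal.IsHomogeneous.bot _) hQ0 hQ
    (fun f hf => by
      rw [Ideal.mem_bot] at hf ⊢
      exact (mul_eq_zero.mp hf).resolve_left hQ0) t
  rw [bot_sup_eq, idealDegree_bot, idealDegree_bot, finrank_bot, add_zero, zero_add] at h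
  exact h

/-- **The box principle modulo a hypersurface of `ℙᵐ`**, `m ≥ 1` (`J = (Q)`, `Q ≠ 0` a form of
degree `1 ≤ a ≤ b`, `M = binom(b+m, b) − binom(b−a+m, b−a) ≥ 1`): for `ω ∈ ℂᵐ` and `N ≥ 1` some form
`R ∉ (Q)` of degree `b` with integer coefficients of modulus `≤ N` has
`|R(1, ω)| ≤ exp(c b − ((M − 4)/2) log(N+1))`, `c = m + 3 + log max(1, ‖ω‖)`. [folklore] -/
theorem boxModHypersurface_exp {m : ℕ} (hm : 1 ≤ m) (ω : Fin m → ℂ) {Q : Rx m} {a b N : ℕ}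
    (hQ : Q.IsHomogeneous a) (hQ0 : Q ≠ 0) (ha : 1 ≤ a) (hab : a ≤ b) (hN : 1 ≤ N) :
    ∃ R : Rx m, R ∉ Ideal.span {Q} ∧ R.IsHomogeneous b ∧ 1 ≤ maxNorm R ∧ maxNorm R ≤ N ∧
      height R ≤ Real.log N ∧
      ‖aeval (Fin.cons 1 ω : Fin (m + 1) → ℂ) R‖ ≤
        Real.exp ((m + 3 + Real.log (max 1 ‖ω‖)) * b -
          ((((b + m).choose b - (b - a + m).choose (b - a) : ℕ) : ℝ) - 4) / 2 *
            Real.log ((N : ℝ) + 1)) := by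
  letI := MvPolynomial.gradedAlgebra (σ := Fin (m + 1)) (R := ℚ)
  have hJ' : (Ideal.span {Q}).IsHomogeneous (homogeneousSubmodule (Fin (m + 1)) ℚ) :=
    Ideal.homogeneous_span _ _ fun x hx => ⟨a, by rw [Set.mem_singleton_iff.mp hx]; exact hQ⟩
  have hJ : ∀ f ∈ Ideal.span {Q}, ∀ d : ℕ, homogeneousComponent d f ∈ Ideal.span {Q} :=
    fun f hf d => MvPolynomial.homogeneousComponent_mem_of_mem hJ' hf d
  have hb : 1 ≤ b := le_trans ha hab
  -- the count `dim (Q)_b = binom(b - a + m, b - a)`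
  have hcount : finrank ℚ ↥(idealDegree (Ideal.span {Q}) b) = (b - a + m).choose (b - a) := by
    have h := finrank_idealDegree_span_singleton hQ hQ0 (b - a)
    rw [Nat.sub_add_cancel hab] at h
    rw [h, finrank_homogeneousSubmodule_eq]
  -- `M ≥ 1`: `binom(b-a+m, b-a) < binom(b+m, b)` because `a ≥ 1` and `m ≥ 1` (Pascal)
  have hlt : (b - a + m).choose (b - a) < (b + m).choose b := by
    obtain ⟨m', rfl⟩ : ∃ m', m = m' + 1 := ⟨m - 1, by omega⟩
    obtain ⟨b', rfl⟩ : ∃ b', b = b' + 1 := ⟨b - 1, by omega⟩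
    rw [Nat.choose_symm_add (a := b' + 1 - a), Nat.choose_symm_add (a := b' + 1),
      show b' + 1 + (m' + 1) = (b' + (m' + 1)) + 1 by ring, Nat.choose_succ_succ']
    have hmono : (b' + 1 - a + (m' + 1)).choose (m' + 1) ≤ (b' + (m' + 1)).choose (m' + 1) :=
      Nat.choose_le_choose _ (by omega)
    have hpos : 0 < (b' + (m' + 1)).choose m' := Nat.choose_pos (by omega)
    omega
  set M : ℕ := (b + m).choose b - (b - a + m).choose (b - a) with hMdef
  have hM : 1 ≤ M := by omega
  have hMJ : M + finrank ℚ ↥(idealDegree (Ideal.span {Q}) b) ≤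
      finrank ℚ ↥(homogeneousSubmodule (Fin (m + 1)) ℚ b) := by
    rw [hcount, finrank_homogeneousSubmodule_eq]
    omega
  exact relativeBox_exp ω hJ hb hM hMJ hN

end RelativeBox

/-- **Registered form** (`stub_relativeBox`, `--supports stmt-Schanuel-6117`): the relative box
principle in `ℙᵐ`, exponential currency, fully quantified. [folklore] -/
theorem stub_relativeBox : ∀ (m : ℕ) (ω : Fin m → ℂ) (J : Ideal (Rx m)), (∀ f ∈ J, ∀ d : ℕ, MvPolynomial.homogeneousComponent d f ∈ J) → ∀ (b M N : ℕ), 1 ≤ b → 1 ≤ M → M + Module.finrank ℚ ↥(Literature.RingTheory.MvPolynomial.idealDegree J b) ≤ Module.finrank ℚ ↥(MvPolynomial.homogeneousSubmodule (Fin (m + 1)) ℚ b) → 1 ≤ N → ∃ R : Rx m, R ∉ J ∧ R.IsHomogeneous b ∧ 1 ≤ maxNorm R ∧ maxNorm R ≤ N ∧ height R ≤ Real.log N ∧ ‖MvPolynomial.aeval (Fin.cons 1 ω : Fin (m + 1) → ℂ) R‖ ≤ Real.exp ((m + 3 + Real.log (max 1 ‖ω‖)) * b - ((M : ℝ) - 4)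 / 2 * Real.log ((N : ℝ) + 1)) :=
  fun _ ω _ hJ _ _ _ hb hM hMJ hN => RelativeBox.relativeBox_exp ω hJ hb hM hMJ hN

end Summit.Schanuel.Schanuel.Cruxes.ApproximationProperty.OrbitInterpolationDeterminant

end
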